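import Literature.Probability.RandomPlanarGeometry.SLESlopeFunctionals
import Literature.Probability.RandomPlanarGeometry.SLEMomentSupersolution
import HarnessLib

/-!
# Schramm's scale function `f_κ(w) = ∫₀ʷ (1 + v²)^{-4/κ} dv` of the SLE slope diffusion

Topic `Probability/RandomPlanarGeometry`; real analysis only (two definitions and their calculus).
This is the first, deterministic layer of the proof of the named fact
`Literature.Probability.RandomPlanarGeometry.Schramm2001_slope_dichotomy` (`SchrammLeftPassage.lean`):
O. Schramm, *A percolation formula*, Electron. Comm. Probab. **6** (2001), proof of Thm. 2 —
for the slope `w = x/y` of `g_t(z₀) - W(t)`, in the clock `du = dt/y²`,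
"`dw = -dW̃ + 4w du/(w² + 1)` … `h` satisfies `(κ/2) h''(w) + (4w/(w² + 1)) h'(w) = 0` …
`h(w) = (f(w) - f(a))/(f(b) - f(a))`, `f(w) := F₂,₁(1/2, 4/κ, 3/2, -w²) w` … by our assumption
`κ < 8` it follows that `lim_{w → ±∞} f(w) = ± √π Γ((8-κ)/(2κ))/(2 Γ(4/κ))`. In particular, the
limit is finite … Hence, the diffusion process (5) is transient."

Here `f` is taken in its integral form: `schrammScale κ w = ∫₀ʷ (1 + v²)^{-4/κ} dv` (the printed
`w ₂F₁(½, 4/κ; 3/2; -w²)` is this integral, by termwise integration of the binomial series of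
`(1 + v²)^{-4/κ}`; that identity and the value of the limit in terms of `Γ` are NOT proved here —
only finiteness of the limit is used downstream). We prove:

* `f' = (1 + w²)^{-4/κ} = rsPow (4/κ)` (`hasDerivAt_schrammScale`), `f ∈ C²`, `f` odd and strictly
  increasing, and **`A f = 0`** for the generator `A F = (κ/2) F'' + (4w/(1+w²)) F'` of the slope
  diffusion (`slopeGen`, `SLESlopeFunctionals.lean`): `slopeGen_schrammScale` — `f` is the SCALE
  FUNCTION of the diffusion (5);
* for `0 < κ < 8`: `(1 + v²)^{-4/κ}` is integrable on `(0, ∞)` (`≤ v^{-8/κ}`, `8/κ > 1`), the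
  supremum `schrammScaleSup κ = ∫₀^∞ (1 + v²)^{-4/κ} dv` is positive and finite,
  `-f(∞) < f(w) < f(∞)` for every `w`, and `f(w) → ± f(∞)` as `w → ±∞`
  (`tendsto_schrammScale_atTop`, `tendsto_schrammScale_atBot`) — "the limit is finite".

## References

* O. Schramm, *A percolation formula*, Electron. Comm. Probab. 6 (2001) 115–120, proof of Thm. 2.
* D. Revuz, M. Yor, *Continuous Martingales and Brownian Motion* (1999), Ch. VII, §3 (scale
  function of a one-dimensional diffusion).
-/

noncomputable section

open Set Filter MeasureTheory intervalIntegral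
open _root_.Topology
open scoped NNReal

namespace Literature.Probability.RandomPlanarGeometry

/-! ### The scale function and its supremum -/

/-- **Schramm's scale function** `f_κ(w) = ∫₀ʷ (1 + v²)^{-4/κ} dv` of the slope diffusion
`dw = -dW̃ + 4w du/(w² + 1)` (Schramm (2001), proof of Thm. 2: `f(w) := F₂,₁(1/2, 4/κ, 3/2, -w²) w`,
here in integral form; `A f = 0`, `slopeGen_schrammScale`). [cite: Schramm2001Percolation, Thm. 2 (proof)] -/
def schrammScale (κ : ℝ≥0) (w : ℝ) : ℝ :=
  ∫ v in (0 : ℝ)..w, rsPow (4 / κ) v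

/-- **`f_κ(+∞) = ∫₀^∞ (1 + v²)^{-4/κ} dv`**, the (finite, for `κ < 8`) limit of the scale function at
`+∞` (Schramm (2001), proof of Thm. 2: "`lim_{w→±∞} f(w) = ± √π Γ((8-κ)/(2κ))/(2Γ(4/κ))` … In
particular, the limit is finite"; the `Γ`-value is not proved here). [cite: Schramm2001Percolation, Thm. 2 (proof)] -/
def schrammScaleSup (κ : ℝ≥0) : ℝ :=
  ∫ v in Ioi (0 : ℝ), rsPow (4 / κ) v

variable (κ : ℝ≥0)

/-- `(1 + w²)^{-β}` is continuous. [folklore] -/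
theorem continuous_rsPow (β : ℝ) : Continuous (rsPow β) :=
  (contDiff_rsPow β (n := 0)).continuous

/-- `(1 + w²)^{-β}` is even. [folklore] -/
theorem rsPow_neg_arg (β w : ℝ) : rsPow β (-w) = rsPow β w := by
  rw [rsPow_apply, rsPow_apply, neg_sq]

/-- Unfolding lemma for `schrammScale`. [folklore] -/
theorem schrammScale_apply (w : ℝ) : schrammScale κ w = ∫ v in (0 : ℝ)..w, rsPow (4 / κ) v := rfl

/-- `f(0) = 0`. [folklore] -/
@[simp] theorem schrammScale_zero : schrammScale κ 0 = 0 := by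
  rw [schrammScale_apply, integral_same]

/-- **`f' = (1 + w²)^{-4/κ}`** (fundamental theorem of calculus). [cite: Schramm2001Percolation, Thm. 2 (proof)] -/
theorem hasDerivAt_schrammScale (w : ℝ) : HasDerivAt (schrammScale κ) (rsPow (4 / κ) w) w :=
  ((continuous_rsPow (4 / κ)).integral_hasStrictDerivAt 0 w).hasDerivAt

/-- `deriv f = (1 + w²)^{-4/κ}`. [folklore] -/
theorem deriv_schrammScale : deriv (schrammScale κ) = rsPow (4 / κ) :=
  funext fun w ↦ (hasDerivAt_schrammScale κ w).deriv

/-- `f` is differentiable. [folklore] -/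
theorem differentiable_schrammScale : Differentiable ℝ (schrammScale κ) := fun w ↦
  (hasDerivAt_schrammScale κ w).differentiableAt

/-- `f` is continuous. [folklore] -/
theorem continuous_schrammScale : Continuous (schrammScale κ) :=
  (differentiable_schrammScale κ).continuous

/-- **`f` is strictly increasing** (`f' > 0`). [cite: Schramm2001Percolation, Thm. 2 (proof)] -/
theorem strictMono_schrammScale : StrictMono (schrammScale κ) :=
  strictMono_of_deriv_pos fun w ↦ by rw [deriv_schrammScale]; exact rsPow_pos _ w

/-- **`f` is odd.** [folklore] -/
theorem schrammScale_neg (w : ℝ) : schrammScale κ (-w) = -schrammScale κ w := by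
  rw [schrammScale_apply, schrammScale_apply]
  have h1 : (∫ v in (0 : ℝ)..-w, rsPow (4 / κ) v) = ∫ v in (0 : ℝ)..-w, rsPow (4 / κ) (-v) := by
    refine integral_congr fun v _ ↦ ?_
    exact (rsPow_neg_arg _ v).symm
  rw [h1, intervalIntegral.integral_comp_neg, neg_neg, neg_zero, integral_symm]

/-- `f(w) > 0` for `w > 0`. [folklore] -/
theorem schrammScale_pos {w : ℝ} (hw : 0 < w) : 0 < schrammScale κ w := by
  simpa using strictMono_schrammScale κ hw

/-- `f''(w) = -(8/κ) w (1 + w²)^{-4/κ-1}` (written `-2 (4/κ) w (1 + w²)^{-4/κ-1}`). [folklore] -/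
theorem iteratedDeriv_two_schrammScale (w : ℝ) :
    iteratedDeriv 2 (schrammScale κ) w = -2 * (4 / κ) * w * (1 + w ^ 2) ^ (-(4 / (κ : ℝ)) - 1) := by
  rw [iteratedDeriv_succ, iteratedDeriv_one, deriv_schrammScale, deriv_rsPow]

/-- **`f ∈ C²(ℝ)`** (indeed smooth; `C²` is what the Itô step consumes). [folklore] -/
theorem contDiff_two_schrammScale : ContDiff ℝ 2 (schrammScale κ) := by
  rw [show (2 : WithTop ℕ∞) = 1 + 1 from rfl, contDiff_succ_iff_deriv, deriv_schrammScale]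
  refine ⟨differentiable_schrammScale κ, fun h ↦ ?_, contDiff_rsPow _⟩
  exact absurd h (by decide)

variable {κ} in
/-- **`A f = 0`: the scale function is harmonic for the generator of the slope diffusion**,
`(κ/2) f'' + (4w/(1 + w²)) f' = (κ/2)(-(8/κ) w (1+w²)^{-4/κ-1}) + 4w (1+w²)^{-4/κ-1} = 0`
(Schramm (2001), proof of Thm. 2: the equation `(κ/2) h'' + (4w/(w²+1)) h' = 0` solved by
`h = (f - f(a))/(f(b) - f(a))`). [cite: Schramm2001Percolation, Thm. 2 (proof)] -/
theorem slopeGen_schrammScale (hκ : 0 < κ) (w : ℝ) : slopeGen κ (schrammScale κ) w = 0 := by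
  have hκ0 : (κ : ℝ) ≠ 0 := by exact_mod_cast hκ.ne'
  have hpos : (0 : ℝ) < 1 + w ^ 2 := one_add_sq_pos' w
  rw [slopeGen_apply, iteratedDeriv_two_schrammScale, deriv_schrammScale, rsPow_apply]
  have hsplit : (1 + w ^ 2) ^ (-(4 / (κ : ℝ))) = (1 + w ^ 2) * (1 + w ^ 2) ^ (-(4 / (κ : ℝ)) - 1) := by
    rw [show -(4 / (κ : ℝ)) = 1 + (-(4 / (κ : ℝ)) - 1) by ring, Real.rpow_add hpos, Real.rpow_one]
    ring_nf
  rw [hsplit]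
  field_simp
  ring

/-! ### Finiteness of `f(±∞)` for `κ < 8` -/

variable {κ}

/-- `(1 + v²)^{-4/κ} ≤ v^{-8/κ}` for `v > 0`. [folklore] -/
theorem rsPow_le_rpow (hκ : 0 < κ) {v : ℝ} (hv : 0 < v) :
    rsPow (4 / κ) v ≤ v ^ (-(8 / (κ : ℝ))) := by
  have hκ0 : (0 : ℝ) < κ := by exact_mod_cast hκ
  have hβ : 0 ≤ 4 / (κ : ℝ) := by positivity
  rw [rsPow_apply]
  have h1 : (1 + v ^ 2) ^ (-(4 / (κ : ℝ))) ≤ (v ^ 2) ^ (-(4 / (κ : ℝ))) :=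
    Real.rpow_le_rpow_of_nonpos (by positivity) (by linarith) (neg_nonpos.2 hβ)
  have h2 : (v ^ 2) ^ (-(4 / (κ : ℝ))) = v ^ (-(8 / (κ : ℝ))) := by
    rw [show (v ^ 2 : ℝ) = v ^ (2 : ℝ) by rw [Real.rpow_two], ← Real.rpow_mul hv.le]
    congr 1
    ring
  rw [← h2]
  exact h1

/-- **`(1 + v²)^{-4/κ}` is integrable on `(0, ∞)` for `0 < κ < 8`** (`8/κ > 1`): Schramm's "by our
assumption `κ < 8` … the limit is finite". [cite: Schramm2001Percolation, Thm. 2 (proof)] -/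
theorem integrableOn_rsPow_Ioi (hκ : 0 < κ) (hκ8 : κ < 8) :
    IntegrableOn (rsPow (4 / κ)) (Ioi (0 : ℝ)) := by
  have hκ0 : (0 : ℝ) < κ := by exact_mod_cast hκ
  have hκ8' : (κ : ℝ) < 8 := by exact_mod_cast hκ8
  have hsplit : Ioi (0 : ℝ) = Ioc 0 1 ∪ Ioi 1 := (Ioc_union_Ioi_eq_Ioi zero_le_one).symm
  rw [hsplit]
  refine IntegrableOn.union ?_ ?_
  · exact ((continuous_rsPow _).continuousOn.integrableOn_compact isCompact_Icc).mono_set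
      Ioc_subset_Icc_self
  · have hlt : -(8 / (κ : ℝ)) < -1 := by
      rw [neg_lt_neg_iff, lt_div_iff₀ hκ0]; linarith
    refine Integrable.mono' (integrableOn_Ioi_rpow_of_lt hlt zero_lt_one)
      (continuous_rsPow _).aestronglyMeasurable ?_
    refine (ae_restrict_mem measurableSet_Ioi).mono fun v hv ↦ ?_
    have hv0 : 0 < v := zero_lt_one.trans hv
    rw [Real.norm_eq_abs, abs_of_pos (rsPow_pos _ v)]
    exact rsPow_le_rpow hκ hv0

/-- **`f(w) → f(∞)` as `w → +∞`.** [cite: Schramm2001Percolation, Thm. 2 (proof)] -/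
theorem tendsto_schrammScale_atTop (hκ : 0 < κ) (hκ8 : κ < 8) :
    Tendsto (schrammScale κ) atTop (𝓝 (schrammScaleSup κ)) :=
  intervalIntegral_tendsto_integral_Ioi 0 (integrableOn_rsPow_Ioi hκ hκ8) tendsto_id

/-- **`f(w) → -f(∞)` as `w → -∞`** (`f` is odd). [cite: Schramm2001Percolation, Thm. 2 (proof)] -/
theorem tendsto_schrammScale_atBot (hκ : 0 < κ) (hκ8 : κ < 8) :
    Tendsto (schrammScale κ) atBot (𝓝 (-schrammScaleSup κ)) := by
  have h := (tendsto_schrammScale_atTop hκ hκ8).comp tendsto_neg_atBot_atTop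
  have h' : Tendsto (fun w ↦ -schrammScale κ (-w)) atBot (𝓝 (-schrammScaleSup κ)) := h.neg
  refine h'.congr fun w ↦ ?_
  rw [schrammScale_neg, neg_neg]

/-- `f(∞) - f(w) = ∫_w^∞ (1 + v²)^{-4/κ} dv` for `w ≥ 0`. [folklore] -/
theorem schrammScaleSup_sub_eq (hκ : 0 < κ) (hκ8 : κ < 8) {w : ℝ} (hw : 0 ≤ w) :
    schrammScaleSup κ - schrammScale κ w = ∫ v in Ioi w, rsPow (4 / κ) v := by
  have h := integral_Ioi_sub_Ioi (integrableOn_rsPow_Ioi hκ hκ8) hw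
  rw [schrammScaleSup, schrammScale_apply]
  linarith

/-- `∫_w^∞ (1 + v²)^{-4/κ} dv > 0`. [folklore] -/
theorem integral_rsPow_Ioi_pos (hκ : 0 < κ) (hκ8 : κ < 8) {w : ℝ} (hw : 0 ≤ w) :
    0 < ∫ v in Ioi w, rsPow (4 / κ) v := by
  have hint : IntegrableOn (rsPow (4 / κ)) (Ioi w) :=
    (integrableOn_rsPow_Ioi hκ hκ8).mono_set (Ioi_subset_Ioi hw)
  have h1 := integral_Ioi_sub_Ioi hint (le_add_of_nonneg_right zero_le_one : w ≤ w + 1)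
  have h2 : 0 < ∫ v in w..(w + 1), rsPow (4 / κ) v :=
    intervalIntegral_pos_of_pos ((continuous_rsPow _).intervalIntegrable _ _)
      (fun v ↦ rsPow_pos _ v) (lt_add_one w)
  have h3 : 0 ≤ ∫ v in Ioi (w + 1), rsPow (4 / κ) v :=
    setIntegral_nonneg measurableSet_Ioi fun v _ ↦ (rsPow_pos _ v).le
  linarith

/-- **`f(∞) > 0`.** [folklore] -/
theorem schrammScaleSup_pos (hκ : 0 < κ) (hκ8 : κ < 8) : 0 < schrammScaleSup κ := by
  have h := schrammScaleSup_sub_eq hκ hκ8 le_rfl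
  rw [schrammScale_zero, sub_zero] at h
  rw [h]
  exact integral_rsPow_Ioi_pos hκ hκ8 le_rfl

/-- **`f(w) < f(∞)` for every `w`.** [cite: Schramm2001Percolation, Thm. 2 (proof)] -/
theorem schrammScale_lt_sup (hκ : 0 < κ) (hκ8 : κ < 8) (w : ℝ) :
    schrammScale κ w < schrammScaleSup κ := by
  rcases le_or_gt 0 w with hw | hw
  · have h := schrammScaleSup_sub_eq hκ hκ8 hw
    linarith [integral_rsPow_Ioi_pos hκ hκ8 hw]
  · calc schrammScale κ w < schrammScale κ 0 := strictMono_schrammScale κ hw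
      _ = 0 := schrammScale_zero κ
      _ < schrammScaleSup κ := schrammScaleSup_pos hκ hκ8

/-- **`-f(∞) < f(w)` for every `w`.** [cite: Schramm2001Percolation, Thm. 2 (proof)] -/
theorem neg_schrammScaleSup_lt (hκ : 0 < κ) (hκ8 : κ < 8) (w : ℝ) :
    -schrammScaleSup κ < schrammScale κ w := by
  have h := schrammScale_lt_sup hκ hκ8 (-w)
  rw [schrammScale_neg] at h
  linarith

/-- `|f(w)| < f(∞)`. [folklore] -/
theorem abs_schrammScale_lt_sup (hκ : 0 < κ) (hκ8 : κ < 8) (w : ℝ) :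
    |schrammScale κ w| < schrammScaleSup κ :=
  abs_lt.2 ⟨neg_schrammScaleSup_lt hκ hκ8 w, schrammScale_lt_sup hκ hκ8 w⟩

/-- `|f(w)| ≤ f(∞)`. [folklore] -/
theorem abs_schrammScale_le_sup (hκ : 0 < κ) (hκ8 : κ < 8) (w : ℝ) :
    |schrammScale κ w| ≤ schrammScaleSup κ :=
  (abs_schrammScale_lt_sup hκ hκ8 w).le

/-- **`f(∞) - f(L₂) → 0` as `L₂ → ∞`**, the form in which the finiteness of `f(∞)` enters the
return estimate (`(f(∞) - f(L₂))/(f(∞) - f(L)) → 0`). [cite: Schramm2001Percolation, Thm. 2 (proof)] -/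
theorem tendsto_schrammScaleSup_sub_atTop (hκ : 0 < κ) (hκ8 : κ < 8) :
    Tendsto (fun L ↦ schrammScaleSup κ - schrammScale κ L) atTop (𝓝 0) := by
  have h := (tendsto_schrammScale_atTop hκ hκ8).const_sub (schrammScaleSup κ)
  rwa [sub_self] at h

end Literature.Probability.RandomPlanarGeometry
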